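import Literature.NumberTheory.EllipticCurves.Kato2004.MemberHullInputs
import Literature.NumberTheory.EllipticCurves.Kato2004.DescentCokernelFiniteOfRankLeOneProofs
import Literature.NumberTheory.EllipticCurves.Kato2004.IwasawaH1ProjZeroKernelProofs
import Literature.NumberTheory.EllipticCurves.Kato2004.IwasawaH1LambdaTorsionFreeProofs
import Literature.NumberTheory.EllipticCurves.AnalyticRankOrderProofs
import Literature.NumberTheory.EllipticCurves.BSDRootNumberNoContinuationProofs
import Literature.NumberTheory.EllipticCurves.MordellWeilRankZeroProofs
import Literature.NumberTheory.EllipticCurves.ComplexMultiplication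
import Literature.NumberTheory.EllipticCurves.IsogenyDualInseparableProofs
import Literature.NumberTheory.EllipticCurves.ShaIsogenyProofs
import Literature.NumberTheory.EllipticCurves.LeadingTerm
import HarnessLib

/-!
# Kato 2004 (Astérisque 295) at Kato's member — the ZETA-ONLY re-type of `MemberHullInputs`
# (Thm. 12.5 (1)–(3), Thm. 12.6 with Lemma 13.10 (1) and 13.14, §14.14 (14.14.1)–(14.14.2),
# Thm. 14.5 (2), Prop. 14.16 (2)): the package `MemberHullZetaInputs`, the fact
# `exists_memberHullZetaInputs`, and the kernel theorems to and from `exists_memberHullInputs`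

Topic `NumberTheory/EllipticCurves`, sub-directory `Kato2004` (namespace = path).  Item `wi-78945`
(planner `bsd-potss-plan` g22 on the recommendation of seat `bsd-potss-rkm` g8/g9,
`HOME/rkm/FINDING-19196-rkm-g8.md`, `…-g9.md` §«What this changes»): a sibling of the held named fact
`Kato2004.exists_memberHullInputs` (file `MemberHullInputs.lean`; item stmt-BirchSwinnertonDyer-19659, child
of crux M stmt-BirchSwinnertonDyer-19196 `ReducibleKatoMember` of the routes K9 / K8-t′) with the SAME outer
hypotheses and the SAME `∃`-shape (member `W′` isogenous to `W`, newform `f`, embeddings `ι`, witnesses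
`κ′ Λ′ c d a A z x` with `ZetaBody …`, every cyclotomic `κ`/`γ`, every `I : IwasawaH1Data`, the lift `𝐲`),
whose inhabited structure `MemberHullZetaInputs W′ p κ γ I 𝐲` keeps exactly the Euler-system / zeta fields
of `MemberHullInputs` — the reflexive hull `j : 𝐇¹_Γ ↪ F` with `z_γ⁰`, the multiplier of Lemma 13.10 (1),
`𝐇²`, the pinned `A = H¹(ℤ[1/p],T)`, the maps of (14.14.1) with the pin of `ι`, the divisibility off
`(p)`, `μ = 0`, the index clause Thm. 14.5 (2) and the count Prop. 14.16 (2) — and DROPS the four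
ALGEBRAIC clauses of `MemberHullInputs` that are THEOREMS of the tree on every pin:

* `finite_H` ((12.2.1), `𝐇¹_Γ` finitely generated) = `IwasawaH1Data.module_finite_of_isCyclotomic`
  (file `IwasawaH1ProjZeroKernelProofs`, p510488);
* `torsionFree_H` (Thm. 12.4 (2)) = `IwasawaH1Data.noZeroSMulDivisors` (file
  `IwasawaH1LambdaTorsionFreeProofs`, p491527);
* `ι_injective` ((14.14.1), injectivity of `𝐇¹_Γ/X𝐇¹_Γ → H¹(ℤ[1/p],T)`) — from the KEPT pin
  `toH1 ∘ ι ∘ mk = proj₀` and `TwistTate.mem_TSubmodule_of_proj_zero_eq_zero` (p510488):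
  `MemberHullZetaInputs.ι_injective` below;
* `finite_coinvariants_H2` (Thm. 14.5 (1) with (14.14.2): `H²(ℤ[1/p],T) = 𝐇²/X𝐇²` finite) — by
  `IwasawaH1Data.finite_descentCokernel_of_rank_le_one` (file `DescentCokernelFiniteOfRankLeOneProofs`)
  and `IwasawaH2Data.finite_descentCokernel_iff_finite_coinvariants_H2` from the base-level bound
  (R0) `rank_{ℤ_p} H¹(ℤ[1/p], T_pW′) ≤ 1` for `W′(ℚ)` and `Ш(W′)[p^∞]` finite, which is the SUMMITS-side
  theorem `IntegralH1RankZero.rank_integralH1_layerZero_le_one` (p517108, rkm g9; a Literature file cannot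
  import it, so it enters the kernel theorem as the displayed hypothesis `hR0`, exactly as (R1) enters
  `IwasawaH1Data.finite_descentCokernel_of_rankOne_of_nontrivial_of_rank_le_one`), with `𝐇¹_Γ ≠ 0` from
  the zeta fields (`MemberHullZetaInputs.nontrivial_H`) and the finiteness of `W′(ℚ)`, `Ш(W′)` transported
  from `L(W,1) ≠ 0`, `Ш(W)` finite along the isogeny (Gross–Zagier–Kolyvagin named fact
  `rank_eq_analyticRank_of_analyticRank_le_one` = the routes' input, `mordellWeilRank_eq_zero_iff_finite`,
  `finite_point_of_isIsogenous`, `IsIsogenous.shaFinite_iff_shaFinite`).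

The clause `index_ne_zero` (Thm. 14.5 (2) with `λ(0) ≠ 0`) is KEPT as the transcription of Thm. 14.5 (2):
rkm g9 showed it is NOT derivable from the other fields as typed (the non-vanishing of the cusp factor of
the chosen datum is in the docstring of the witness clause, not in its formal text); the planner's other
option (adding `cuspFactor … ≠ 0` to the `ZetaBody` witness clause) is not taken here and remains open.

## Contents

* `MemberHullZetaInputs W p κ γ I y` — the zeta-only hypothesis structure (fields = those of
  `MemberHullInputs` minus `finite_H`, `torsionFree_H`, `ι_injective`, `finite_coinvariants_H2`; same
  names, same types, same pins);
* `MemberHullInputs.toMemberHullZetaInputs` (forgetful) and `MemberHullZetaInputs.toMemberHullInputs`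
  (given `Finite (coinvariants p H2)`), `…toMemberHullInputs_of_rank_integralH1_le_one` (given (R0) at the
  pin), with `nontrivial_H`, `ι_injective`, `toIwasawaH2Data`, `finite_coinvariants_H2_of_rank_integralH1_le_one`;
* the named fact `exists_memberHullZetaInputs` (a CONSTRUCTION fact, D-0014, size XL like its sibling);
* kernel theorems `exists_memberHullZetaInputs_of_memberHullInputs : exists_memberHullInputs →
  exists_memberHullZetaInputs` (the re-type is WEAKER) and
  `exists_memberHullInputs_of_zetaInputs : rank_eq_analyticRank_of_analyticRank_le_one → (R0) →
  exists_memberHullZetaInputs → exists_memberHullInputs`.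

HONEST SCOPE.  Nothing is booked by the re-type: `exists_memberHullZetaInputs` is still the transcription
of Kato Thm. 12.5 / 12.6 / 13.10 / 14.5 (2) / 14.16 (2) at the member (Kato's Euler system, explicit
reciprocity, Poitou–Tate — no `_holds` expected); it only moves PROVED module algebra out of hypothesis
position.  The consumer (planner: `--resplit ReducibleKatoMember … --glue ReducibleKatoMemberOfZetaInputs`)
discharges `hR0` by `IntegralH1RankZero.rank_integralH1_layerZero_le_one` and the GZK antecedent by the
routes' `PublishedInputRankEqAnalyticRankW`.  BSD is not advanced; see `MemberHullInputs.lean` ("WHAT THE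
ABSTRACT FIELDS DO AND DO NOT PIN") for what a package of this kind certifies.

## References

* K. Kato, *p-adic Hodge theory and values of zeta functions of modular forms*, Astérisque 295 (2004):
  §8.3 (p. 181), (12.2.1) (p. 220), Thm. 12.4, Thm. 12.5 (pp. 221–222), Thm. 12.6, Rem. 12.7 (p. 222),
  13.9, Lemma 13.10 (1) (pp. 229–230), 13.14 (p. 234), Thm. 14.5 (p. 236), §14.8 (p. 238), §14.14
  (14.14.1)–(14.14.2), 14.13 (p. 243), Prop. 14.16 (2) (p. 244) — store key `paper:doi-10-24033-ast-639`,
  read through `MemberHullInputs.lean` (whose module docstring quotes every statement verbatim). [Kato2004Asterisque]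
* C. Wuthrich, Doc. Math. 19 (2014), Lemma 12 (p. 395), Lemma 14 (p. 396). [Wuthrich2014]
* R. Greenberg, LNM 1716 (1999), Prop. 4.13 and §3. [GreenbergLNM1716]
* C.-H. Kim, Amer. J. Math. 148 (2026), §3.2.3. [Kim2022StructureSelmer]
* H. Darmon, *Rational points on modular elliptic curves*, CBMS 101 (2004), Thm. 3.22 (Gross–Zagier,
  Kolyvagin). [Darmon2004]
* Tree: `MemberHullInputs.lean` (the sibling), `IwasawaH2Descent.lean` (`IwasawaH2Data`),
  `DescentCokernelFiniteOfRankLeOneProofs.lean`, `IwasawaH1ProjZeroKernelProofs.lean`,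
  `IwasawaH1LambdaTorsionFreeProofs.lean`, `IwasawaH1RankLeOneProofs.lean` (the (R1) precedent for `hR0`);
  Summits side (not imported): `Theorems/KatoDescentPotSupersingularIntegralH1RankZero.lean` ((R0),
  `MemberHullInputs.finite_coinvariants_H2_of_otherFields`).
-/

noncomputable section

open scoped NumberField TensorProduct
open Field IsDedekindDomain CongruenceSubgroup
open Literature.NumberTheory.GaloisRepresentations
open Literature.NumberTheory.EllipticCurves Literature.NumberTheory.EllipticCurves.ModularForms
open Literature.NumberTheory.EllipticCurves.Kato2004
open Literature.NumberTheory.EllipticCurves.Kato2004.EulerSystemValues Rat.HeightOneSpectrum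
open Literature.NumberTheory.EllipticCurves.IwasawaAlgebra

namespace Literature.NumberTheory.EllipticCurves.Kato2004

section Package

variable (W : WeierstrassCurve ℚ) [W.IsElliptic] (p : ℕ) [Fact p.Prime]
  [ContinuousSMul ℤ_[p] (W.tateModule p)] (κ : ZpExtension ℚ p) (γ : absoluteGaloisGroup ℚ)
  (I : IwasawaH1Data W p κ γ) (y : I.H)

/-- **Kato's rank-`0` descent inputs at his own lattice, ZETA-ONLY re-type of `MemberHullInputs` —
hypothesis structure (a package of the printed statements; nothing asserted).**  For an elliptic curve
`W/ℚ` (intended: Kato's member `W_K`, `T_pW ≅ V_{ℤ_p}(f)(1)`), a pinned Iwasawa cohomology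
`I : IwasawaH1Data W p κ γ` and an element `y : I.H` (the `Λ`-adic class of a `ZetaBody` family): the
reflexive hull `j : I.H ↪ F` (13.14 / Wuthrich L.12), Kato's normalised zeta element `z = z_γ⁰ ∈ F`,
`z ≠ 0`, `F/Λz` torsion (Thm. 12.5 (1)(2)), the multiplier `lam ∈ Λ` of Lemma 13.10 (1) with
`j y = lam • z`, `lam(0) ≠ 0`; the abstract `H2 = 𝐇²(T)⁰`, finitely generated torsion ((12.2.1),
Thm. 12.4 (1)); the module `A = H¹(ℤ[1/p],T)` PINNED to `integralH1 (tateRep W p) p (κ.layerSubgroup 0)`;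
the maps `ι`, `π` of (14.14.1) with `π` surjective, exactness in the middle and the PIN
`toH1 ∘ ι ∘ mk = proj₀`; Thm. 12.5 (3) + Rem. 12.7 off `(p)`; `μ(𝐇²(T)⁰) = 0` (Wuthrich L.14, reducible
`W[p]`); Thm. 14.5 (2) (`index_ne_zero`); and the COUNT Prop. 14.16 (2) + §14.8 / Greenberg 4.13 + Kim
§3.2.3 + Thm. 12.5 (1) for the element `y` (module docstring of `MemberHullInputs.lean`, "the COUNT").
EXACTLY the field list of `MemberHullInputs` with the four tree-proved algebraic clauses `finite_H`,
`torsionFree_H`, `ι_injective`, `finite_coinvariants_H2` removed (module docstring); same names, types, pins.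
[cite: Kato2004Asterisque, Thm. 12.4 (1) (p. 221), Thm. 12.5 (1)–(3) (pp. 221–222), Thm. 12.6 and Rem. 12.7 (p. 222), Lemma 13.10 (1) (p. 230), 13.14 (p. 234), Thm. 14.5 (2) (p. 236), §14.14 (14.14.1)–(14.14.2) (p. 243), Prop. 14.16 (2) (p. 244), §14.8 (p. 238)]
[cite: Wuthrich2014, Lemma 12 (p. 395), Lemma 14 (p. 396)] [cite: GreenbergLNM1716, Prop. 4.13 and §3 after Lemma 3.3]
[cite: Kim2022StructureSelmer, §3.2.3 display before Thm. 3.7 (PDF p. 16)] -/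
structure MemberHullZetaInputs : Type 1 where
  /-- The reflexive hull `F = (𝐇¹_Γ)^{**}` (13.14 / Wuthrich L.12), abstract. -/
  F : Type
  [addCommGroupF : AddCommGroup F]
  [moduleF : _root_.Module (IwasawaAlgebra p) F]
  /-- `F` is finitely generated. -/
  finite_F : Module.Finite (IwasawaAlgebra p) F
  /-- `F` is torsion free. -/
  torsionFree_F : NoZeroSMulDivisors (IwasawaAlgebra p) F
  /-- The inclusion `𝐇¹_Γ ↪ (𝐇¹_Γ)^{**}`. -/
  j : I.H →ₗ[IwasawaAlgebra p] F
  /-- `j` is injective. -/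
  j_injective : Function.Injective j
  /-- The hull has finite (pseudo-null) cokernel. -/
  finite_coker : Finite (F ⧸ LinearMap.range j)
  /-- Kato's normalised zeta element `z_γ⁰` (`γ^+` a `ℤ_p`-basis of `T(−1)^+`), in the hull
  (Thm. 12.6 + 13.14). -/
  z : F
  /-- `z_γ⁰ ≠ 0` (Thm. 12.5 (1) with 13.5 / 14.5 (2)). -/
  z_ne_zero : z ≠ 0
  /-- Thm. 12.5 (2) with 12.4 (2): `F/Λz` is torsion (rank one). -/
  isTorsion_quotient : Module.IsTorsion (IwasawaAlgebra p) (F ⧸ (IwasawaAlgebra p) ∙ z)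
  /-- Lemma 13.10 (1): the multiplier `λ ∈ Λ` of the `(c,d,a(A))`-class. -/
  lam : IwasawaAlgebra p
  /-- Lemma 13.10 (1): `j y = λ • z_γ⁰`. -/
  j_y : j y = lam • z
  /-- `λ(0) ≠ 0` (the admissible `(c,d,a,A)` chosen with `γ_*^+ ≠ 0`). -/
  lam_constantCoeff_ne_zero : PowerSeries.constantCoeff lam ≠ 0
  /-- `H2 = 𝐇²(T)⁰`, abstract. -/
  H2 : Type
  [addCommGroupH2 : AddCommGroup H2]
  [moduleH2 : _root_.Module (IwasawaAlgebra p) H2]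
  /-- (12.2.1): `𝐇²` is finitely generated. -/
  finite_H2 : Module.Finite (IwasawaAlgebra p) H2
  /-- Thm. 12.4 (1): `𝐇²` is torsion. -/
  isTorsion_H2 : Module.IsTorsion (IwasawaAlgebra p) H2
  /-- `A = H¹(ℤ[1/p], T)` as a `Λ`-module (through the augmentation), pinned by `toH1`. -/
  A : Type
  [addCommGroupA : AddCommGroup A]
  [moduleA : _root_.Module (IwasawaAlgebra p) A]
  /-- The PIN of `A`: an additive map to `H¹(ℚ, T_pW)` at the bottom layer `κ.layerSubgroup 0 = Γ_ℚ` … -/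
  toH1 : A →+ H1 (tateRep W p) (κ.layerSubgroup 0)
  /-- … injective … -/
  toH1_injective : Function.Injective toH1
  /-- … with image exactly the integral classes `H¹(ℤ[1/p], T_pW)` (§8.2, Lemma 8.5) … -/
  mem_range_toH1_iff : ∀ x : H1 (tateRep W p) (κ.layerSubgroup 0),
    x ∈ Set.range toH1 ↔ x ∈ integralH1 (tateRep W p) p (κ.layerSubgroup 0)
  /-- … and `Λ` acting on `A` through the augmentation `g ↦ g(0)` (so `X` acts as `0`). -/
  toH1_smul : ∀ (g : IwasawaAlgebra p) (a : A), toH1 (g • a) = PowerSeries.constantCoeff g • toH1 a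
  /-- (14.14.1), first map `𝐇¹_Γ/X𝐇¹_Γ → H¹(ℤ[1/p],T)`. -/
  ι : coinvariants p I.H →ₗ[IwasawaAlgebra p] A
  /-- (14.14.1), second map `H¹(ℤ[1/p],T) → 𝐇²[X]`. -/
  π : A →ₗ[IwasawaAlgebra p] invariants p H2
  /-- (14.14.1): `π` surjective. -/
  π_surjective : Function.Surjective π
  /-- (14.14.1): exact in the middle. -/
  exact_ι_π : Function.Exact ι π
  /-- The PIN of `ι`: `ι(x mod X) = proj₀ x` in `H¹(ℚ, T_pW)` (§13.8 / (14.14.1); `IwasawaH1Data.projZero`). -/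
  toH1_ι : ∀ x : I.H, toH1 (ι (Submodule.Quotient.mk x)) = I.proj 0 x
  /-- Thm. 12.5 (3) with Rem. 12.7 (potentially good `p`: `𝐇²_loc = 0`), on the `Δ`-trivial component:
  `ℓ_𝔮(𝐇²) ≤ ℓ_𝔮(F/Λz_γ)` at every height-one `𝔮 ≠ (p)`. -/
  divisibility_offP : ∀ 𝔮 : PrimeSpectrum (IwasawaAlgebra p), 𝔮.asIdeal.height = 1 →
    𝔮.asIdeal ≠ augIdealP p →
      Module.lengthAt (IwasawaAlgebra p) H2 𝔮 ≤
        Module.lengthAt (IwasawaAlgebra p) (F ⧸ (IwasawaAlgebra p) ∙ z) 𝔮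
  /-- Wuthrich 2014 Lemma 14 + global duality (reducible `W[p]`, `p` odd): `μ(𝐇²(T)⁰) = 0`. -/
  mu_H2 : muInvariant p H2 = 0
  /-- Thm. 14.5 (2) with `λ(0) ≠ 0`: `y₀` is non-torsion in the rank-one `A`, `[A : Λ·ι(ȳ)] ≠ 0`. -/
  index_ne_zero :
    Nat.card (A ⧸ (IwasawaAlgebra p) ∙ ι (Submodule.Quotient.mk y)) ≠ 0
  /-- THE COUNT (Prop. 14.16 (2) for the element `y₀ = proj₀ y` + §14.8 / Greenberg Prop. 4.13 & §3 +
  Kim §3.2.3 + Thm. 12.5 (1) with Lemma 13.10 (1); module docstring of `MemberHullInputs.lean`):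
  `ord_p #Ш(W)[p^∞] + v_p(Tam W) + ord_p [A : Λ·ι(ȳ)] ≤ ord_p(L(W,1)/Ω(W)) + v_p(λ(0)) + ord_p #(𝐇²/X𝐇²)
  + 3·ord_p #W(ℚ)_tors`. -/
  count : ∃ q : ℚ, W.entireLFunction 1 / (W.realPeriodRat : ℂ) = (q : ℂ) ∧
    (padicValNat p (Nat.card (AddCommGroup.primaryComponent W.sha p)) : ℤ) +
        padicValNat p W.tamagawaProduct +
        padicValNat p (Nat.card (A ⧸ (IwasawaAlgebra p) ∙ ι (Submodule.Quotient.mk y))) ≤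
      padicValRat p q + ((PowerSeries.constantCoeff lam).valuation : ℤ) +
        padicValNat p (Nat.card (coinvariants p H2)) + 3 * (padicValNat p W.torsionOrder : ℤ)

attribute [instance] MemberHullZetaInputs.addCommGroupF MemberHullZetaInputs.moduleF
  MemberHullZetaInputs.addCommGroupH2 MemberHullZetaInputs.moduleH2
  MemberHullZetaInputs.addCommGroupA MemberHullZetaInputs.moduleA

end Package

/-! ## The four dropped clauses are theorems; conversions between the two packages -/

section Conversions

variable {W : WeierstrassCurve ℚ} [W.IsElliptic] {p : ℕ} [Fact p.Prime]
  [ContinuousSMul ℤ_[p] (W.tateModule p)] {κ : ZpExtension ℚ p} {γ : absoluteGaloisGroup ℚ}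
  {I : IwasawaH1Data W p κ γ} {y : I.H}

/-- **The re-type is WEAKER: every `MemberHullInputs` package forgets to a `MemberHullZetaInputs` package**
(drop the four algebraic clauses). [cite: Kato2004Asterisque, Thm. 12.5 (1)–(3) (pp. 221–222), §14.14 (14.14.1) (p. 243)] -/
def MemberHullInputs.toMemberHullZetaInputs (D : MemberHullInputs W p κ γ I y) :
    MemberHullZetaInputs W p κ γ I y where
  F := D.F
  finite_F := D.finite_F
  torsionFree_F := D.torsionFree_F
  j := D.j
  j_injective := D.j_injective
  finite_coker := D.finite_coker
  z := D.z
  z_ne_zero := D.z_ne_zero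
  isTorsion_quotient := D.isTorsion_quotient
  lam := D.lam
  j_y := D.j_y
  lam_constantCoeff_ne_zero := D.lam_constantCoeff_ne_zero
  H2 := D.H2
  finite_H2 := D.finite_H2
  isTorsion_H2 := D.isTorsion_H2
  A := D.A
  toH1 := D.toH1
  toH1_injective := D.toH1_injective
  mem_range_toH1_iff := D.mem_range_toH1_iff
  toH1_smul := D.toH1_smul
  ι := D.ι
  π := D.π
  π_surjective := D.π_surjective
  exact_ι_π := D.exact_ι_π
  toH1_ι := D.toH1_ι
  divisibility_offP := D.divisibility_offP
  mu_H2 := D.mu_H2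
  index_ne_zero := D.index_ne_zero
  count := D.count

namespace MemberHullZetaInputs

/-- **On a zeta package the pin is non-zero**: `j y = λ • z` with `z ≠ 0`, `λ(0) ≠ 0` in the torsion-free
hull `F` forces `y ≠ 0`, so `𝐇¹_Γ = I.H` is non-trivial (the hypothesis of the pin-level finiteness of the
descent cokernel beyond the finiteness of `W(ℚ)` and `Ш[p^∞]`; rkm g9's `MemberHullInputs.nontrivial_H`,
same proof). [cite: Kato2004Asterisque, Thm. 12.5 (1)(2) (pp. 221–222) and Lemma 13.10 (1) (p. 230)] -/
theorem nontrivial_H (Z : MemberHullZetaInputs W p κ γ I y) : Nontrivial I.H := by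
  haveI := Z.torsionFree_F
  have hlam : Z.lam ≠ 0 := fun h => Z.lam_constantCoeff_ne_zero (by rw [h, map_zero])
  have hy : y ≠ 0 := by
    intro h
    apply smul_ne_zero hlam Z.z_ne_zero
    rw [← Z.j_y]
    subst h
    exact map_zero Z.j
  exact nontrivial_of_ne y 0 hy

/-- **The dropped clause `ι_injective` ((14.14.1): `𝐇¹_Γ/X𝐇¹_Γ → H¹(ℤ[1/p],T)` is injective) is a
THEOREM on every zeta package** (`κ` cyclotomic, `γ` a topological generator): by the pin
`toH1 (ι (mk x)) = proj₀ x` and the injectivity of `toH1`, `ι (mk x) = 0` gives `proj₀ x = 0`, hence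
`x ∈ X·𝐇¹_Γ` by `TwistTate.mem_TSubmodule_of_proj_zero_eq_zero` (rkm g8), i.e. `mk x = 0`.
[cite: Kato2004Asterisque, §14.14 (14.14.1) (p. 243) and §13.8 (p. 228)] -/
theorem ι_injective (Z : MemberHullZetaInputs W p κ γ I y) (hκ : κ.IsCyclotomic)
    (hγ : κ.IsTopGenerator γ) : Function.Injective Z.ι := by
  rw [injective_iff_map_eq_zero]
  intro x hx
  induction x using Submodule.Quotient.induction_on with
  | H x =>
    have h0 : I.proj 0 x = 0 := by rw [← Z.toH1_ι x, hx, map_zero]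
    exact (Submodule.Quotient.mk_eq_zero _).mpr
      (TwistTate.mem_TSubmodule_of_proj_zero_eq_zero W p κ hκ hγ I x h0)

/-- The `(H2, A, toH1, ι, π)`-fields of a zeta package form a descent package `IwasawaH2Data W p κ γ I`
(the injectivity of `ι` supplied by `ι_injective`). [cite: Kato2004Asterisque, §14.14 (14.14.1) (p. 243), (12.2.1) (p. 220), Thm. 12.4 (1) (p. 221)] -/
def toIwasawaH2Data (Z : MemberHullZetaInputs W p κ γ I y) (hκ : κ.IsCyclotomic)
    (hγ : κ.IsTopGenerator γ) : IwasawaH2Data W p κ γ I where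
  H2 := Z.H2
  finite_H2 := Z.finite_H2
  isTorsion_H2 := Z.isTorsion_H2
  A := Z.A
  toH1 := Z.toH1
  toH1_injective := Z.toH1_injective
  mem_range_toH1_iff := Z.mem_range_toH1_iff
  toH1_smul := Z.toH1_smul
  ι := Z.ι
  π := Z.π
  ι_injective := Z.ι_injective hκ hγ
  π_surjective := Z.π_surjective
  exact_ι_π := Z.exact_ι_π
  toH1_ι := Z.toH1_ι

/-- **The dropped clause `finite_coinvariants_H2` (Thm. 14.5 (1) with (14.14.2): `H²(ℤ[1/p],T) = 𝐇²/X𝐇²`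
is finite) from the base-level bound `rank_{ℤ_p} H¹(ℤ[1/p], T_pW) ≤ 1`** on a zeta package (`κ` cyclotomic,
`γ` a topological generator): `𝐇¹_Γ` is finitely generated (`module_finite_of_isCyclotomic`), torsion free
(`isTorsionFree`) and non-zero (`nontrivial_H`), `proj₀` is injective modulo `X`
(`TwistTate.mem_TSubmodule_of_proj_zero_eq_zero`), so the descent cokernel is finite
(`IwasawaH1Data.finite_descentCokernel_of_rank_le_one`), which on the descent package `toIwasawaH2Data` is
`Finite (coinvariants p H2)` (`IwasawaH2Data.finite_descentCokernel_iff_finite_coinvariants_H2`).  The rank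
bound is (R0) (`W(ℚ)`, `Ш[p^∞]` finite; Summits `IntegralH1RankZero.rank_integralH1_layerZero_le_one`) or
(R1). [cite: Kato2004Asterisque, Thm. 14.5 (1) (p. 236), 14.13 and §14.14 (14.14.1)–(14.14.2) (p. 243)] -/
theorem finite_coinvariants_H2_of_rank_integralH1_le_one (Z : MemberHullZetaInputs W p κ γ I y)
    (hκ : κ.IsCyclotomic) (hγ : κ.IsTopGenerator γ)
    (hrank : Module.rank ℤ_[p] (integralH1 (tateRep W p) p (κ.layerSubgroup 0)) ≤ 1) :
    Finite (coinvariants p Z.H2) := by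
  haveI := IwasawaH1Data.module_finite_of_isCyclotomic hκ hγ I
  haveI := I.isTorsionFree hγ
  haveI := Z.nontrivial_H
  have hfin : Finite I.descentCokernel := I.finite_descentCokernel_of_rank_le_one
    (fun x hx ↦ TwistTate.mem_TSubmodule_of_proj_zero_eq_zero W p κ hκ hγ I x hx) hrank
  exact (Z.toIwasawaH2Data hκ hγ).finite_descentCokernel_iff_finite_coinvariants_H2.mp hfin

/-- **From a zeta package to a full `MemberHullInputs` package, given `Finite (coinvariants p H2)`**:
`finite_H`, `torsionFree_H`, `ι_injective` are supplied by the tree theorems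
`IwasawaH1Data.module_finite_of_isCyclotomic`, `IwasawaH1Data.noZeroSMulDivisors`, `ι_injective`
(`κ` cyclotomic, `γ` a topological generator). [cite: Kato2004Asterisque, (12.2.1) (p. 220), Thm. 12.4 (2) (p. 221), §14.14 (14.14.1) (p. 243), Thm. 14.5 (1) (p. 236)] -/
def toMemberHullInputs (Z : MemberHullZetaInputs W p κ γ I y) (hκ : κ.IsCyclotomic)
    (hγ : κ.IsTopGenerator γ) (hH2 : Finite (coinvariants p Z.H2)) : MemberHullInputs W p κ γ I y where
  finite_H := IwasawaH1Data.module_finite_of_isCyclotomic hκ hγ I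
  torsionFree_H := IwasawaH1Data.noZeroSMulDivisors hγ I
  F := Z.F
  finite_F := Z.finite_F
  torsionFree_F := Z.torsionFree_F
  j := Z.j
  j_injective := Z.j_injective
  finite_coker := Z.finite_coker
  z := Z.z
  z_ne_zero := Z.z_ne_zero
  isTorsion_quotient := Z.isTorsion_quotient
  lam := Z.lam
  j_y := Z.j_y
  lam_constantCoeff_ne_zero := Z.lam_constantCoeff_ne_zero
  H2 := Z.H2
  finite_H2 := Z.finite_H2
  isTorsion_H2 := Z.isTorsion_H2
  A := Z.A
  toH1 := Z.toH1
  toH1_injective := Z.toH1_injective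
  mem_range_toH1_iff := Z.mem_range_toH1_iff
  toH1_smul := Z.toH1_smul
  ι := Z.ι
  π := Z.π
  ι_injective := Z.ι_injective hκ hγ
  π_surjective := Z.π_surjective
  exact_ι_π := Z.exact_ι_π
  toH1_ι := Z.toH1_ι
  divisibility_offP := Z.divisibility_offP
  mu_H2 := Z.mu_H2
  finite_coinvariants_H2 := hH2
  index_ne_zero := Z.index_ne_zero
  count := Z.count

/-- **From a zeta package to a full `MemberHullInputs` package, given the base-level bound
`rank_{ℤ_p} H¹(ℤ[1/p], T_pW) ≤ 1`** ((R0)/(R1) at the pin). [cite: Kato2004Asterisque, Thm. 14.5 (1) (p. 236), §14.14 (14.14.1)–(14.14.2) (p. 243)] -/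
def toMemberHullInputs_of_rank_integralH1_le_one (Z : MemberHullZetaInputs W p κ γ I y)
    (hκ : κ.IsCyclotomic) (hγ : κ.IsTopGenerator γ)
    (hrank : Module.rank ℤ_[p] (integralH1 (tateRep W p) p (κ.layerSubgroup 0)) ≤ 1) :
    MemberHullInputs W p κ γ I y :=
  Z.toMemberHullInputs hκ hγ (Z.finite_coinvariants_H2_of_rank_integralH1_le_one hκ hγ hrank)

end MemberHullZetaInputs

end Conversions

/-! ## The named fact: the zeta package exists at Kato's member -/

/-- **Kato 2004, Thm. 12.5 (1)–(3), 12.6 + Lemma 13.10 (1) + 13.14, §14.14 (14.14.1)–(14.14.2), Thm. 14.5 (2),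
Prop. 14.16 (2) + §14.8 (with Greenberg Prop. 4.13 / §3, Kim §3.2.3), (12.2.1) and Thm. 12.4 (1) for `𝐇²`,
and Wuthrich 2014 Lemma 14, AT KATO'S LATTICE `T = V_{ℤ_p}(f)(1)`: the ZETA-ONLY rank-`0` descent inputs
EXIST at Kato's member.**  For every globally minimal elliptic curve `W/ℚ` and every prime `p ≠ 2` of
ADDITIVE, POTENTIALLY GOOD (`0 ≤ ord_p j(W)`) reduction with `W[p]` REDUCIBLE, `L(W,1) ≠ 0` and `Ш(W/ℚ)`
finite, there is a GLOBALLY MINIMAL curve `W_K/ℚ`, `ℚ`-isogenous to `W` (Kato's member: `T_pW_K ≅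
V_{ℤ_p}(f)(1)`, §8.3 + *AEC* III.4.12 — displayed existentially), such that for the newform `f` of `W` and
every family of complex embeddings `ι` there are witnesses `(κ', Λ', c, d, a, A, z, x)` with `κ' ≠ 0`,
`A ≥ 1`, `(c, 6pA) = 1`, `(d, 6pN) = 1` satisfying `ZetaBody W_K p f ι κ' Λ' c d a A z x`, AND for every
cyclotomic `ℤ_p`-tower `κ` with topological generator `γ`, every `I : IwasawaH1Data W_K p κ γ` and THE
element `𝐲 ∈ I.H` lifting the corestricted `p`-power levels (`IwasawaH1Data.existsUnique_lift_of_zetaBody`),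
the structure `MemberHullZetaInputs W_K p κ γ I 𝐲` is inhabited.  VERBATIM the outer text of
`exists_memberHullInputs` with `MemberHullZetaInputs` for `MemberHullInputs`: the four algebraic clauses
`finite_H`, `torsionFree_H`, `ι_injective`, `finite_coinvariants_H2` of the sibling are theorems
(module docstring) and are restored by `exists_memberHullInputs_of_zetaInputs`; conversely
`exists_memberHullZetaInputs_of_memberHullInputs`.  A CONSTRUCTION fact (D-0014): weaker than print (the
identity of `F`, `𝐇²` is forgotten), never stronger; nothing asserted; no `_holds` expected (size XL: Kato's
Euler system, explicit reciprocity, Poitou–Tate).  Referee flag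
`Kato-12.6-13.10-14.16(2)-member-reading-reducible` as for the sibling.
[cite: Kato2004Asterisque, §8.3 (p. 181), (12.2.1) (p. 220), Thm. 12.4 (1) (p. 221), Thm. 12.5 (1)–(3) (pp. 221–222), Thm. 12.6 and Rem. 12.7 (p. 222), 13.9 and Lemma 13.10 (1) (pp. 229–230), 13.14 (p. 234), Thm. 14.5 (2) (p. 236), §14.8 (p. 238), §14.14 (14.14.1)–(14.14.2) (p. 243), Prop. 14.16 (2) (p. 244), (8.1.3) (p. 180), Ex. 13.3 (p. 225), Prop. 8.12 (p. 186), Thm. 9.7 (p. 189), Thm. 6.6 (1) (p. 163)]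
[cite: Wuthrich2014, §3.2 and Lemma 12 (pp. 394–395), Lemma 14 (p. 396)]
[cite: GreenbergLNM1716, Prop. 4.13 and the paragraph following its proof; §3 after Lemma 3.3]
[cite: Kim2022StructureSelmer, §3.2.3 display before Thm. 3.7 (PDF p. 16)]
[cite: SilvermanAEC2009, Prop. III.4.12 with Rem. III.4.13.2] -/
def exists_memberHullZetaInputs : Prop :=
  ∀ (W : WeierstrassCurve ℚ) [W.IsElliptic] [W.IsGloballyMinimal] (p : ℕ) [Fact p.Prime]
    (hp : p ≠ 2),
    ¬ W.HasGoodReductionAtPrime p → ¬ W.HasMultiplicativeReductionAtPrime p →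
    0 ≤ padicValRat p W.j →
    ¬ W.HasIrreducibleModPGaloisRep p →
    W.entireLFunction 1 ≠ 0 → Finite W.sha →
    ∃ (W' : WeierstrassCurve ℚ) (_ : W'.IsElliptic) (_ : W'.IsGloballyMinimal),
      WeierstrassCurve.IsIsogenous W W' ∧
      ∀ [ContinuousSMul ℤ_[p] (W'.tateModule p)] [Module.Free ℤ_[p] (W'.tateModule p)]
        [Module.Finite ℤ_[p] (W'.tateModule p)],
      ∀ {N : ℕ} [NeZero N] (f : CuspForm (Gamma0 N) 2), IsNewformOf W f →
      ∀ (ι : (m : ℕ) → (CyclotomicField m ℚ →+* ℂ)),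
      ∃ (κ' : ℝ) (Λ' : ∀ (k : ℕ) (r : Finset (HeightOneSpectrum (𝓞 ℚ))),
          H1 (tateRep W' p) (cycSubgroup p k r) →ₗ[ℤ_[p]] ℚ_[p] ⊗[ℚ] CyclotomicField (cycLevel p k r) ℚ)
        (c d a : ℤ) (A : ℕ)
        (z : ∀ (k : ℕ) (r : (cyclotomicLevelsRat p (badPlaces c d A N)).Ideals),
          H1 (tateRep W' p) ((cyclotomicLevelsRat p (badPlaces c d A N)).level k r.1))
        (x : ∀ (k : ℕ) (r : (cyclotomicLevelsRat p (badPlaces c d A N)).Ideals),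
          CyclotomicField (cycLevel p k r.1) ℚ),
        κ' ≠ 0 ∧ 0 < A ∧ Int.gcd c (6 * p * A) = 1 ∧ Int.gcd d (6 * p * N) = 1 ∧
        ZetaBody W' p f ι κ' Λ' c d a A z x ∧
        ∀ (κ : ZpExtension ℚ p) (γ : absoluteGaloisGroup ℚ) (hκ : κ.IsCyclotomic),
          κ.IsTopGenerator γ →
          ∀ (I : IwasawaH1Data W' p κ γ) (y : I.H),
            (∀ n : ℕ, I.proj n y = levelToLayer W' p hκ hp (badPlaces c d A N) n
              (z (n + 1) (cyclotomicLevelsRat p (badPlaces c d A N)).idealOne)) →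
            Nonempty (MemberHullZetaInputs W' p κ γ I y)

/-! ## Kernel theorems between the two facts -/

/-- **The re-type is implied by the sibling**: `exists_memberHullInputs → exists_memberHullZetaInputs`
(forget the four algebraic clauses). [cite: Kato2004Asterisque, Thm. 12.5 (1)–(3) (pp. 221–222), §14.14 (14.14.1) (p. 243)] -/
theorem exists_memberHullZetaInputs_of_memberHullInputs (h : exists_memberHullInputs) :
    exists_memberHullZetaInputs := by
  intro W _ _ p _ hp hgood hmult hj hirr hL hsha
  obtain ⟨W', hW'e, hW'm, hiso, hrest⟩ := h W p hp hgood hmult hj hirr hL hsha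
  refine ⟨W', hW'e, hW'm, hiso, ?_⟩
  intro _ _ _ N _ f hf ι
  obtain ⟨κ', Λ', c, d, a, A, z, x, hκ', hA, hc, hd, hZB, hall⟩ := hrest f hf ι
  refine ⟨κ', Λ', c, d, a, A, z, x, hκ', hA, hc, hd, hZB, ?_⟩
  intro κ γ hκ hγ I y hy
  obtain ⟨D⟩ := hall κ γ hκ hγ I y hy
  exact ⟨D.toMemberHullZetaInputs⟩

/-- `L(W,1) ≠ 0` forces analytic rank `0` (in the junk branch without an entire `L`-function the analytic
rank is `0` by convention, `analyticRank_eq_zero_of_not_hasEntireLFunction`; otherwise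
`analyticRank_eq_zero_iff_holds`). [cite: BirchSwinnertonDyer1965] -/
private theorem analyticRank_eq_zero_of_L_one_ne_zero (W : WeierstrassCurve ℚ) [W.IsElliptic]
    (hL : W.entireLFunction 1 ≠ 0) : W.analyticRank = 0 := by
  by_cases hE : W.HasEntireLFunction
  · exact (WeierstrassCurve.analyticRank_eq_zero_iff_holds (W := W) hE).mpr hL
  · exact W.analyticRank_eq_zero_of_not_hasEntireLFunction hE

/-- **The sibling from the re-type: `exists_memberHullZetaInputs → exists_memberHullInputs`, given the
Gross–Zagier–Kolyvagin input `rank_eq_analyticRank_of_analyticRank_le_one` (to know that `W(ℚ)`, hence the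
member's `W_K(ℚ)`, is finite when `L(W,1) ≠ 0`) and the base-level bound (R0)
«`W(ℚ)` finite → `Ш(W)[p^∞]` finite → `rank_{ℤ_p} H¹(ℤ[1/p], T_pW) ≤ 1`» displayed as the hypothesis `hR0`**
— (R0) is the Summits-side theorem `IntegralH1RankZero.rank_integralH1_layerZero_le_one` (Kato 14.13 /
Thm. 14.5 (1) in rank `0`, proved Euler-system-free by finite-level local Tate duality), which a Literature
file cannot import; the consumer discharges `hR0` by it verbatim.  On each pin of the member: `W_K(ℚ)` is
finite (GZK at `W`, `mordellWeilRank_eq_zero_iff_finite`, `finite_point_of_isIsogenous`), `Ш(W_K)` is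
finite (`IsIsogenous.shaFinite_iff_shaFinite`), so (R0) applies and
`MemberHullZetaInputs.toMemberHullInputs_of_rank_integralH1_le_one` restores the four algebraic clauses.
[cite: Kato2004Asterisque, Thm. 14.5 (1) (p. 236), 14.13 and §14.14 (14.14.1)–(14.14.2) (p. 243), (12.2.1) (p. 220), Thm. 12.4 (2) (p. 221)]
[cite: Darmon2004, Thm. 3.22 (= Thm. 1.14) and §3.9] -/
theorem exists_memberHullInputs_of_zetaInputs (hGZK : rank_eq_analyticRank_of_analyticRank_le_one)
    (hR0 : ∀ (W : WeierstrassCurve ℚ) [W.IsElliptic] (p : ℕ) [Fact p.Prime]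
      [ContinuousSMul ℤ_[p] (W.tateModule p)] (κ : ZpExtension ℚ p) [Finite W.toAffine.Point]
      [Finite (AddCommGroup.primaryComponent W.sha p)],
      Module.rank ℤ_[p] (integralH1 (tateRep W p) p (κ.layerSubgroup 0)) ≤ 1)
    (h : exists_memberHullZetaInputs) : exists_memberHullInputs := by
  intro W _ _ p _ hp hgood hmult hj hirr hL hsha
  obtain ⟨W', hW'e, hW'm, hiso, hrest⟩ := h W p hp hgood hmult hj hirr hL hsha
  haveI := hW'e
  -- `W(ℚ)` is finite: analytic rank `0` and Gross–Zagier–Kolyvagin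
  have h0 : W.analyticRank = 0 := analyticRank_eq_zero_of_L_one_ne_zero W hL
  obtain ⟨hrk, -⟩ := hGZK W (by rw [h0]; exact zero_le_one)
  rw [h0] at hrk
  haveI hWfin : Finite W.toAffine.Point := (W.mordellWeilRank_eq_zero_iff_finite).mp hrk
  -- transported along the isogeny to the member
  haveI hW'fin : Finite W'.toAffine.Point := finite_point_of_isIsogenous hiso.symm_of_isElliptic hWfin
  have hshaW' : W'.ShaFinite := hiso.shaFinite_iff_shaFinite.mp hsha
  haveI : Finite W'.sha := hshaW'
  refine ⟨W', hW'e, hW'm, hiso, ?_⟩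
  intro _ _ _ N _ f hf ι
  obtain ⟨κ', Λ', c, d, a, A, z, x, hκ', hA, hc, hd, hZB, hall⟩ := hrest f hf ι
  refine ⟨κ', Λ', c, d, a, A, z, x, hκ', hA, hc, hd, hZB, ?_⟩
  intro κ γ hκ hγ I y hy
  obtain ⟨Z⟩ := hall κ γ hκ hγ I y hy
  exact ⟨Z.toMemberHullInputs_of_rank_integralH1_le_one hκ hγ (hR0 W' p κ)⟩

end Literature.NumberTheory.EllipticCurves.Kato2004

end
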